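import Summits.CriticalPhenomena.PercolationContinuityZ3.Theorems.PercNearOneGluingNoHeavyLowerTailRefinedRowR3Switching
import HarnessLib

/-!
# `NoHeavyLowerTail` (stmt-CriticalPhenomena-4575) — THEOREM R4 of the separating-cluster refinement:
# `u_a · s_a ≤ u_b · (b₀ + s_b)` on EVERY finite weighted graph, by ONE cluster exchange

Support file (prover prim-gen-kcluster gen 42; `--supports stmt-CriticalPhenomena-4575`).  No named facts, no sorries,
no definitions (the cells are those of `…RefinedRowR3Switching`).

Setting (KCLUSTER-gen32 §4 / gen33 / gen35 / gen42 of run/shared/lean/prim/prim-gen-kcluster/): Bernoulli bond percolation with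
arbitrary edge probabilities `p` on the support `D ⊆ Sym2 V` (configurations `X ⊆ D`, masses `PrW D p`), terminals `a b c`,
`cl X v` the open cluster of `v`, `Sep D W u v` = the vertex set `W` meets every `u–v` path of the support.  The three-point cell
`a|b|c` is refined as `S_a ⊔ S_b ⊔ S_c ⊔ B_0` (which cluster separates the other two terminals; none), and
`RefinedRowR3.cellUc x y z = {y ∈ cl X x, z ∉ cl X x}` is the two-point cell `xy|z`; so `cellUc b c a` is `u_a` (`bc|a`) and
`cellUc a c b` is `u_b` (`ac|b`).

**Theorem R4** (`r4_PrW`): if `b, c ∈ cl D a` (the terminals lie in one component of the support) then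
`PrW(bc|a) · PrW(S_a) ≤ PrW(ac|b) · (PrW(B_0) + PrW(S_b))`, i.e. `u_a s_a ≤ u_b (b₀ + s_b)`
(and, exchanging `b` and `c`, `u_a s_a ≤ u_c (b₀ + s_c)`).  This is a fourth quadratic row of the refinement, next to
R1 `t s_a ≤ u_b u_c` (= `DualBHK.dualBHK` ∘ `RefinedRowR1.r1_PrW`), R2 `u_a s_a ≤ t b₀` (`RefinedRowR2.r2_PrW`, Ahlswede–Daykin)
and R3 `s_a s_b ≤ u_c b₀` (`RefinedRowR3.r3_PrW`); by an exact LP (gen-32 `refined_lp_cert.py`, 201 generators) R4 is NOT a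
nonnegative combination of the 153 Harris rows of the refined poset, Gladkov's `AG`/`AG_S`, R1–R3 with all relabellings and
monomials.  Census (gen 42, `pol_hunt.c` exact DP + weight hill-climbing, all graphs on ≤ 6 vertices; fibrewise on all graphs
n ≤ 5, m ≤ 7): 0 violations.  It was found as the exact difference between the `MASTER({a,b},{b},{a,b};{c},{c},{c})`
instance of `DualBHK.master_univ` (root inside a hub) and dual BHK.

**Proof** (KCLUSTER-gen42.md §2): two independent copies `(X, Y)` and the Gladkov–Zimin one-cluster exchange along `L = cl X c`,
`swapPair (fun X => touch (cl X c))`, which preserves `μ ⊗ μ` (`DecisionTree.Pr2W_preimage_swapPair`,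
`Gladkov.selfDetermined_touch_cl`).  POINTWISE (`pointwise`): for `X ∈ S_a`, `Y ∈ U_a ∪ S_b ∪ B_0` the first output
`P = (X on touch L | Y elsewhere)` is in `B_0 ∪ S_b` — its `c`-cluster is the sealed `L` (F1), which does not separate `a|b`
because `cl X a` separates `b|c` (`not_sep_sep`); its `a`- and `b`-clusters are sub-clusters of `Y`'s (F2), so it is apart
and its `a`-cluster does not separate `b|c` (for `Y ∈ U_a` the `Y`-open `b–c` path avoids `cl Y a`) — and the second
output `Q = (Y on touch L | X elsewhere)` is in `U_b ∪ S_a`: it keeps `cl X a` (F3), and its `b`-cluster stays inside the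
support component of `b` off `cl X a` (`cl_splice_subset_Rc` with `b ↔ c`), which contains neither `a` nor `c`.  Hence
`s_a (u_a + s_b + b₀) = μ⊗μ(S_a × (U_a ∪ S_b ∪ B_0)) ≤ μ⊗μ((B_0 ∪ S_b) × (U_b ∪ S_a)) = (b₀ + s_b)(u_b + s_a)`.
[cite: GladkovZimin2024, Lemma 4.2 and Example 4.4 (one-cluster exchange)] for the exchange; the refined cells and the row are this
programme's (KCLUSTER-gen32/33/42).
-/

noncomputable section

namespace Summit.CriticalPhenomena.PercolationContinuityZ3.Theorems

namespace RefinedRowR4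

open Finset Literature.Probability.Percolation Literature.Probability.Percolation.DecisionTree
open Literature.Probability.Percolation.Gladkov ThreePointLB RefinedRowR3
open scoped Classical

variable {V : Type*} [Fintype V] [DecidableEq V]

/-! ### The pointwise lemma -/

section Pointwise

variable {D : Finset (Sym2 V)} {a b c : V}

/-- `S_a` is symmetric under exchanging `b` and `c`. [this work] -/
theorem cellSa_swap {X : Finset (Sym2 V)} (hX : X ∈ cellSa D a b c) : X ∈ cellSa D a c b := by
  obtain ⟨⟨hab, hac, hbc⟩, hsep⟩ := hX
  exact ⟨⟨hac, hab, fun h => hbc (mem_cl_comm.1 h)⟩, sep_comm.1 hsep⟩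

/-- **Pointwise lemma** (KCLUSTER-gen42 §2): for `X ∈ S_a`, `Y ∈ U_a ∪ S_b ∪ B_0` (both inside a support joining `a, b, c`),
the exchange along `touch (cl X c)` sends `(X, Y)` to `(B_0 ∪ S_b) × (U_b ∪ S_a)`. [this work] -/
theorem pointwise {X Y : Finset (Sym2 V)} (hXD : X ⊆ D) (hYD : Y ⊆ D) (hDb : b ∈ cl D a) (hDc : c ∈ cl D a)
    (hX : X ∈ cellSa D a b c) (hY : Y ∈ cellUc b c a ∪ (cellSb D a b c ∪ cellB0 D a b c)) :
    splice (touch (cl X c)) X Y ∈ cellB0 D a b c ∪ cellSb D a b c ∧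
      splice (touch (cl X c)) Y X ∈ cellUc a c b ∪ cellSa D a b c := by
  have hX' := hX
  obtain ⟨⟨hab, hac, hbc⟩, hsep⟩ := hX
  set K := cl X a with hK
  set L := cl X c with hL
  set P := splice (touch L) X Y with hP
  set Q := splice (touch L) Y X with hQ
  have hca : a ∉ L := fun h => hac (mem_cl_comm.1 h)
  have hcb : b ∉ L := fun h => hbc (mem_cl_comm.1 h)
  -- facts about Y: `b ∉ cl Y a`, and the `a`-cluster of `Y` does not separate `b|c`
  have hYab : b ∉ cl Y a := by
    rcases hY with hY | hY | hY
    · exact fun h => hY.2 (mem_cl_comm.1 h)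
    · exact hY.1.1
    · exact hY.1.1
  have hYnsa : ¬ Sep D (cl Y a) b c := by
    rcases hY with hY | hY | hY
    · -- `Y ∈ U_a`: the `Y`-open `b–c` path avoids `cl Y a`
      intro h
      have hsub : cl Y b ⊆ cl (D \ touch (cl Y a)) b :=
        cl_subset_cl_sdiff_touch hYD fun v hv => not_mem_cl_of_mem_cl hv hY.2
      exact h (hsub hY.1)
    · exact fun h => not_sep_sep hYD hYab hDc h hY.2
    · exact hY.2.1
  -- (1) P ∈ B_0 ∪ S_b
  have hPc : cl P c = L := cl_splice_touch X Y c
  have hPa : ∀ u, u ∈ cl P a ↔ u ∈ cl (Y \ touch L) a := fun u => mem_cl_splice_touch_iff_of_not_mem hca u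
  have hPb : ∀ u, u ∈ cl P b ↔ u ∈ cl (Y \ touch L) b := fun u => mem_cl_splice_touch_iff_of_not_mem hcb u
  have hPaY : cl P a ⊆ cl Y a := fun u hu => cl_mono Finset.sdiff_subset a ((hPa u).1 hu)
  have hP_ab : b ∉ cl P a := fun h => hYab (hPaY h)
  have hP_ac : c ∉ cl P a := fun h => not_mem_of_mem_cl_sdiff_touch hca ((hPa c).1 h) (mem_cl_self X c)
  have hP_bc : c ∉ cl P b := fun h => not_mem_of_mem_cl_sdiff_touch hcb ((hPb c).1 h) (mem_cl_self X c)
  have hP_nsa : ¬ Sep D (cl P a) b c := fun h => hYnsa (h.mono hPaY)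
  have hP_nsc : ¬ Sep D (cl P c) a b := by
    rw [hPc]
    exact fun h => not_sep_sep (x := a) (y := c) (z := b) hXD hac hDb (sep_comm.1 hsep) h
  have hP1 : P ∈ cellB0 D a b c ∪ cellSb D a b c := by
    by_cases hP_sb : Sep D (cl P b) a c
    · exact Or.inr ⟨⟨hP_ab, hP_ac, hP_bc⟩, hP_sb⟩
    · exact Or.inl ⟨⟨hP_ab, hP_ac, hP_bc⟩, hP_nsa, hP_sb, hP_nsc⟩
  -- (2) Q ∈ U_b ∪ S_a
  have hKQ : K ⊆ cl Q a := cl_subset_cl_splice_touch_of_not_mem hca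
  have hQb : cl Q b ⊆ cl (D \ touch K) b := cl_splice_subset_Rc hXD hYD (cellSa_swap hX')
  have hQ_ab : b ∉ cl Q a := fun h =>
    not_mem_of_mem_cl_sdiff_touch hab (hQb (mem_cl_comm.1 h)) (mem_cl_self X a)
  have hQ_bc : c ∉ cl Q b := fun h => hsep (hQb h)
  have hP2 : Q ∈ cellUc a c b ∪ cellSa D a b c := by
    by_cases hQ_ac : c ∈ cl Q a
    · exact Or.inl ⟨hQ_ac, hQ_ab⟩
    · exact Or.inr ⟨⟨hQ_ab, hQ_ac, hQ_bc⟩, hsep.mono hKQ⟩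
  exact ⟨hP1, hP2⟩

end Pointwise

/-! ### THEOREM R4 -/

section Measure

variable (D : Finset (Sym2 V)) {p : Sym2 V → ℝ} (hp0 : ∀ e, 0 ≤ p e) (hp1 : ∀ e, p e ≤ 1) (a b c : V)
include hp0 hp1

/-- **THEOREM R4** (`u_a · s_a ≤ u_b · (b₀ + s_b)` on every finite weighted graph whose support joins the terminals):
`PrW(bc|a) · PrW(S_a) ≤ PrW(ac|b) · (PrW(B_0) + PrW(S_b))`.  One Gladkov–Zimin cluster exchange along `cl X c`
(`Pr2W_preimage_swapPair`) and the pointwise lemma. [this work] -/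
theorem r4_PrW (hDb : b ∈ cl D a) (hDc : c ∈ cl D a) :
    PrW D p (cellUc b c a) * PrW D p (cellSa D a b c) ≤
      PrW D p (cellUc a c b) * (PrW D p (cellB0 D a b c) + PrW D p (cellSb D a b c)) := by
  set Fm : Finset (Sym2 V) → Finset (Sym2 V) := fun X => touch (cl X c) with hFm
  have hF : SelfDetermined Fm := selfDetermined_touch_cl c
  set S : Set (Finset (Sym2 V) × Finset (Sym2 V)) :=
    cellSa D a b c ×ˢ (cellUc b c a ∪ (cellSb D a b c ∪ cellB0 D a b c)) with hS
  set T : Set (Finset (Sym2 V) × Finset (Sym2 V)) :=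
    (cellB0 D a b c ∪ cellSb D a b c) ×ˢ (cellUc a c b ∪ cellSa D a b c) with hT
  -- the exchange maps S into T (on pairs inside the support)
  have hST : Pr2W D p S ≤ Pr2W D p (swapPair Fm ⁻¹' T) := by
    refine Pr2W_mono D hp0 hp1 fun x hx1 hx2 hx => ?_
    obtain ⟨hX, hY⟩ := Set.mem_prod.1 hx
    have key := pointwise hx1 hx2 hDb hDc hX hY
    show swapPair Fm x ∈ T
    exact Set.mem_prod.2 ⟨key.1, key.2⟩
  rw [Pr2W_preimage_swapPair D p hF T] at hST
  -- factorise both sides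
  have hdisj1 : Disjoint (cellSb D a b c) (cellB0 D a b c) :=
    Set.disjoint_left.2 fun X h1 h2 => h2.2.2.1 h1.2
  have hdisj2 : Disjoint (cellUc b c a) (cellSb D a b c ∪ cellB0 D a b c) :=
    Set.disjoint_left.2 fun X h1 h2 => by
      rcases h2 with h2 | h2
      · exact h2.1.2.2 h1.1
      · exact h2.1.2.2 h1.1
  have hdisj3 : Disjoint (cellB0 D a b c) (cellSb D a b c) :=
    Set.disjoint_left.2 fun X h1 h2 => h1.2.2.1 h2.2
  have hdisj4 : Disjoint (cellUc a c b) (cellSa D a b c) :=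
    Set.disjoint_left.2 fun X h1 h2 => h2.1.2.1 h1.1
  rw [hS, Pr2W_prod, PrW_union D p hdisj2, PrW_union D p hdisj1] at hST
  rw [hT, Pr2W_prod, PrW_union D p hdisj3, PrW_union D p hdisj4] at hST
  have hsa := PrW_nonneg D hp0 hp1 (cellSa D a b c)
  have hb0 := PrW_nonneg D hp0 hp1 (cellB0 D a b c)
  have hsb := PrW_nonneg D hp0 hp1 (cellSb D a b c)
  nlinarith [hST, hsa, hb0, hsb]

/-- R4 in slack form: `0 ≤ u_b (b₀ + s_b) − u_a s_a`. [this work] -/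
theorem r4_PrW' (hDb : b ∈ cl D a) (hDc : c ∈ cl D a) :
    0 ≤ PrW D p (cellUc a c b) * (PrW D p (cellB0 D a b c) + PrW D p (cellSb D a b c)) -
      PrW D p (cellUc b c a) * PrW D p (cellSa D a b c) :=
  sub_nonneg.2 (r4_PrW D hp0 hp1 a b c hDb hDc)

end Measure

end RefinedRowR4

end Summit.CriticalPhenomena.PercolationContinuityZ3.Theorems

end
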